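import Mathlib
import Literature.MathematicalPhysics.QuantumFieldTheory.Balaban1983to89.T4InputCauchyRateSecant

/-!
# T4InputCauchyRateSharp — the load-bearing smallness `ω + Λ·c < θ′` of the lineage's NE5 closures is SHARP at the typed
# interface: a two-parameter family of step models meeting EVERY consumed hypothesis set of the closures (represented runs,
# base class, EXACT data-Lipschitz / operator-Lipschitz / class-wide history-secant moduli `Λ = 1`, one-run bounds, operator
# rate `θ_op = ω`, identical insertions, natural history gain `c` at age damping `ω`) whose NE5 rates are EXACTLY
# `[ω + c, ∞)`; file v1.1 DECIDES THE THRESHOLD RATE ITSELF: off resonance (`θ_op ≠ ω + Λ·c`) it is ATTAINED by every pair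
# obeying the recursive budget — the renewal recursion solved exactly, no smallness hypothesis — and at resonance
# (`θ_op = ω + Λ·c`) it is NOT, on a second family (cell `pub-balaban`, T⁴-continuum fan-out, node U3 / spine estimate NE5,
# prover seat P1 = "cluster-expansion derivative bound: differentiate B13's convergent expansion in V and bound term-wise
# (analyticity strip ⇒ Cauchy estimate)"; a SIBLING LEAF of `T4InputCauchyRateSecant` (file v1, frozen), which it imports
# BY NAME and does not modify; file v1.1 = v1 + §5–§8, ADDITIVE: v1's §1–§4 are byte-identical)

HONEST FRAMING. The cell's T4 target is rung (B)+1 (existence AND uniqueness of the ε → 0 limit of Bałaban's unit-scale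
expectations on a FIXED finite torus T⁴); NOT infinite volume, NOT a mass gap, NOT the Clay problem. The conditionals of
the spine (BetaPertH, (B), (B^μ)) are untouched here and stay explicit wherever the spine composes (`T4OutputRate`
docstring; T4-DAG §2). NOTHING printed in [Balaban1987RG1], [Balaban1988RG2Cluster], [Balaban1988Convergent] is asserted:
this module contains NO new hypothesis shape and NO reading of print; it is kernel-checked real-number analysis about the
SHAPES of the imported leaves (`T4InputCauchyRateData` v5, `T4InputCauchyRateSpecies` v1.4, `T4InputCauchyRateSecant` v1)
on the toy carriers of `T4InputCauchyRate` v1. The estimate NE5 is NOT PRINTED (cell GAPS G-t4-U3-1) and is not claimed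
here for any actual step; NOT summit progress.

THE QUESTION IT SETTLES (census row S of the cell wall sheet `WALLS-NE5-P1.md`; record `t4/T4-EST-NE5-P1.md` §36–§40).
Every closure of the lineage delivers NE5 at the rates `θ′ ∈ (max(θ_op, ω + Λ·c), 1]` only — `Λ` the CONSUMED output
modulus in the newest previous action (`StepModel.DataLipschitz` of file v5 §11; the history-species modulus `Λhist` of
`T4InputCauchyRateSpecies.DataLipschitz₂` §2; the class-wide secant modulus `Λhist` of `T4InputCauchyRateSecant.HistSecant`
§2), `c` the natural history gain and `ω` the age damping of `StepModel.InsertionDampedNat` — with a constant blowing up at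
the threshold. So far the threshold was ONE-SIDED knowledge: a sufficient condition produced by summing the geometric
series of the mixed recursion `D_k ≤ Aθ^k + Σ_{j<k} b·ω^{k−j}·D_j` (`T4InputCauchyRate.RecursiveRate`), possibly an
artefact of that proof. This leaf makes it TWO-SIDED at the interface: NO argument consuming only these hypothesis sets
can conclude NE5 at any rate `θ′ < ω + Λ·c`, because a model meeting all of them (with `Λ = 1`) violates it there (file
v1, §1–§4); and it decides the remaining point `θ′ = max(θ_op, ω + Λ·c)` ITSELF (file v1.1, §5–§8).

THE WITNESS (§1–§2). Carriers `toyCarriers` (domains = creation steps `k : ℕ`, no tree length, trivial backgrounds); for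
parameters `ω c : ℝ` the model `sharpModel ω c`: output `Out(o, h) = o + h` (entire; Lipschitz with modulus EXACTLY `1` in
each species at unit margins — for every reach, and across every class), operator data `ω^k` versus `0` (operator rate
`θ_op = ω`, `δ = 1`), the SAME insertion for both runs (`δ′ = 0`) reading the whole earlier table with GEOMETRIC MEMORY
`ins_k(t) = c·Σ_{j<k} ω^{k−1−j}·t(j)` (`sharpIns`: linear; `InsertionDampedNat κ c ω` — natural gain `c`, damping `ω`),
base class `{(0, 0)}`; run B `≡ 0` (`T4InputCauchyRate.toyEB`), run A `E_A(k) = (ω + c)^k` (`sharpEA ω c`) — represented,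
because `c·Σ_{j<k} ω^{k−1−j}(ω + c)^j = (ω + c)^k − ω^k` (`mul_sharpSum`: the discrepancy recursion behind the closures
holds with EQUALITY at every scale). §2 checks every consumed hypothesis: `RepresentsA/B`, `InBase`, `OutputEnvelope`
(`G = 2`), `DataLipschitz κ 1 ρ₀` (every `ρ₀`), `DataLipschitz₂ κ 1 1 ρ₀`, `OpLipschitz κ 1 ρ₀`, `HistSecant K κ 1`
(every class `K`), `HistPairInClass` (universal class), `DecayBound` (`EA₀ = 1` for `0 ≤ ω + c ≤ 1`; `E₀ = 0`),
`OperatorRate 1 ω`, `InsertionRate κ E₀ 0 θ`, `InsLinear` / `InsAffine`, `InsertionDampedNat κ c ω`.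

WHAT IS PROVED (§3; [folklore] throughout; `0 < ω`, `0 ≤ c`, `ω + c ≤ 1` where needed). (i) THE CLOSURES FIRE down to
the threshold: `sharp_ne5_lip` — file v5's `StepModel.ne5_at_of_stepModel_lip_nat` applies for every `θ′ ∈ (ω + c, 1]`
(reach `ρ₀ = 1 + c/(1 − ω)` from the first scale: `k₀ = 0`, `B = 0`); `sharp_ne5_secant` — `T4InputCauchyRateSecant`'s
`ne5_at_of_stepModel_secant_nat` likewise (universal class, operator reach `1`). (ii) NE5 HOLDS AT AND ABOVE the threshold
with constant `1`: `sharp_ne5_of_le : ω + c ≤ θ′ → NE5 (sharpEA ω c) toyEB univ 0 θ′ 1`. (iii) NE5 FAILS BELOW IT for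
every constant: `sharp_not_ne5_of_lt : θ′ < ω + c → ¬ NE5 (sharpEA ω c) toyEB univ 0 θ′ C₅` (for `θ′ ≤ 0` from the
scales 1 and 2; for `0 < θ′ < ω + c` because `((ω + c)/θ′)^k` is unbounded); hence
`sharp_ne5_iff : (∃ C₅, NE5 (sharpEA ω c) toyEB univ 0 θ′ C₅) ↔ ω + c ≤ θ′`, and for `c > 0`
`sharp_not_ne5_at_input_rate`: the outputs converge STRICTLY SLOWER than every input of the step (operators at rate `ω`,
insertions identical) — the rate loss through the history feed is real at the interface, not an artefact of the proofs.
§4: the numbers at `ω = 1/2`, `c = 1/4` (threshold `3/4`; the closures' constant `(θ′ − 1/2)/(θ′ − 3/4) ≥ 2` on `(3/4, 1]`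
against the true constant `1`).

FILE v1.1 (ADDITIVE, §5–§8): THE THRESHOLD RATE ITSELF. File v1 left one slack: the closures need the STRICT
`ω + Λ·c < θ′`, with a constant `↑ ∞` at the threshold, while the witness has NE5 AT `ω + c` with constant `1`. §5 solves
the renewal recursion behind `RecursiveRate` EXACTLY — `renewal_identity`: a sequence with `E_0 = A` and
`E_{k+1} = (1 + b)ω·E_k + Aθ^k(θ − ω)` solves `E_k = Aθ^k + Σ_{j<k} bω^{k−j}E_j` with equality; a nonnegative exact
solution bounds the discrepancies scale by scale (`boundedAtScale_of_solution`) — and decides the slack. (α) OFF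
RESONANCE, input rate `θ` STRICTLY BELOW the threshold `(1 + b)ω`: `RecursiveRate` ALONE gives NE5 AT the rate `(1 + b)ω`
with the `k`-UNIFORM constant `A·max(1, bω/((1 + b)ω − θ))` and NO smallness hypothesis (`ne5_threshold_of_recursiveRate`:
`ω ≤ θ`, exact solution `A[bω((1 + b)ω)^k − (θ − ω)θ^k]/((1 + b)ω − θ)`; `ne5_threshold_of_recursiveRate_of_le`: `θ ≤ ω`,
constant `A`; `ne5_threshold_of_recursiveRate'`: both); with file v1's `ne5_of_recursiveRate` (`θ > (1 + b)ω`) the budget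
gives NE5 AT `max(θ, (1 + b)ω)` whenever `θ ≠ (1 + b)ω` (`ne5_at_max_of_recursiveRate`) and at every larger rate always
(`ne5_above_max_of_recursiveRate`). §6 carries (α) to the two `Λ`-faced closures the witness family meets:
`ne5_threshold_of_stepModel_lip_nat` IS file v5's `StepModel.ne5_at_of_stepModel_lip_nat` with its smallness
`ω + Λ·c < θ′` REPLACED by `θ < ω + Λ·c` and the conclusion AT `θ′ = ω + Λ·c` (constant
`(Λ(δ + δ′) + B)·max(1, Λc/(ω + Λc − θ))`; `ω < 1` now explicit), and `ne5_threshold_of_stepModel_secant_nat` IS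
`T4InputCauchyRateSecant.ne5_at_of_stepModel_secant_nat` so modified. §7 checks that (α) is EXACT on the witness of §1:
the general closure returns `NE5 (sharpEA ω c) toyEB univ 0 (ω + c) 1` (`sharp_ne5_threshold_lip`,
`sharp_ne5_at_threshold_of_closure`) — the rate AND the constant of `sharp_ne5_of_le`. (β) AT RESONANCE `θ = (1 + b)ω`
the exact solution is `A(1 + k·b/(1 + b))((1 + b)ω)^k` (`boundedAtScale_resonance_of_recursiveRate`): a LINEARLY GROWING
prefactor — NE5 at every `θ′ > (1 + b)ω` (`resSeq_le`: `(1 + k·c/r)r^k ≤ (1 + c/(θ′ − r))θ′^k`), no uniform constant at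
the threshold, and none exists: the RESONANT WITNESS `resModel ω c` of §7 — `sharpModel ω c` with the operator data moved
to the threshold rate, `(ω + c)^k` versus `0`, so `θ_op = ω + c = ω + Λ·c`; run A `resEA ω c = (1 + k·c/(ω + c))(ω + c)^k`,
represented because it solves the recursion exactly (`res_sum`) and ATTAINING the resonance budget
(`res_attains_resonance_budget`); every consumed hypothesis again holds (`res_representsA/B`, `res_inBase`,
`res_outputEnvelope`, `res_dataLipschitz`, `res_dataLipschitz₂`, `res_opLipschitz`, `res_histSecant`,
`res_histPairInClass`, `res_decayA` with `EA₀ = 1 + c/(1 − (ω + c))` for `ω + c < 1`, `res_operatorRate 1 (ω + c)`,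
`res_insertionRate`, `res_insLinear/Affine`, `res_insertionDampedNat`) — has NE5 rates EXACTLY the OPEN half-line
`{θ′ | ω + c < θ′}`: `res_ne5_of_gt` (constant `1 + c/(θ′ − (ω + c))`), `res_ne5_lip` (file v5's closure fires on
`(ω + c, 1]`), `res_not_ne5_of_le` (fails at every `θ′ ≤ ω + c` for every constant: `E_A(k)/(ω + c)^k = 1 + k·c/(ω + c)` is
unbounded), `res_ne5_iff`, `resonance_two_sided`. §8: the numbers at `ω = 1/2`, `c = 1/4` (`threshold_three_quarters`:
AT `3/4` the general closure gives constant `1` on the §1 witness, while on the resonant witness NE5 at `3/4` fails and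
holds at `θ′ = 1` with constant `2`).

WHAT IT MEANS, HONESTLY ([analysis]; no census VALUE changes; lettering as record §38.4/§40). (a) Row S is TWO-SIDED at
the interface and, with file v1.1, DECIDED AT EVERY RATE: for pairs obeying the recursive budget with parameters
`(θ_op, ω, b)` the closures give NE5 on `[max(θ_op, (1 + b)ω), ∞)` off resonance and on `(θ_op, ∞)` at resonance
`θ_op = (1 + b)ω`, and both shapes OCCUR as the exact rate sets of models meeting every consumed hypothesis set with
`(Λ, bω) = (1, c)`: the closed half-line from the threshold (§1, `θ_op = ω`: `sharp_ne5_iff`) and the open one (§7,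
`θ_op = ω + c`: `res_ne5_iff`). File v1's sentence (d) "the closures' constant tends to `∞` at the threshold, where the
true constant is `1`" is thereby SHARPENED: off resonance the blow-up was an artefact of the geometric-series proof (the
exact solution has a uniform constant at the threshold, and the general closure returns the true constant `1` on the §1
witness), at resonance it is the truth (no constant exists at the threshold). Only the product `Λ·c` is margin-gauge-invariant
(`T4InputCauchyRateSpecies` NUMBERS (g)); the families realise every value of it. (b) The census question "is the
exponent loss `a < ᾱ` at fixed `ε₁` an artefact of the proof?" keeps its answer NO at the interface: no argument consuming
only these hypothesis sets concludes NE5 below `ω + Λ·c`; the exponent restriction of the census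
(`T4InputCauchyRateData` NUMBERS (e), `T4InputCauchyRateSpecies` (f)–(g″), `T4InputCauchyRateSecant` (h)) is the TRUE
CONTENT of those hypotheses up to the now-admissible endpoint, and an NE5 exponent closer to the input exponent needs an
input BEYOND them — a history gain or modulus DECAYING in `k`, or a cancellation between the operator and the history
channels — none of which this lineage has located in print (the levels `E₀`, `ε₁` and the age factor of
[Balaban1988RG2Cluster] p. 8–9 are uniform in `k`; loci on the lineage sheet `b13-loci.md`). Whether the threshold
exponent itself is admissible (`≤` versus `<`) is not census currency: downstream (node U3) consumes NE5 at SOME `θ′ < 1`.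
(c) FACES: both witnesses are face-independent (every `Λ`-faced hypothesis of the Lipschitz, species and secant faces
holds with modulus `1`), and §6 gives the threshold version of the Lipschitz and secant faces; the Cauchy-faced closures
(`…near_nat`, fibre / class / budget / termwise) are not instantiated on the families and are not sharp for them (on these
models Cauchy's modulus from the envelope `G = 2` is `2/(1 − ρ₀) > 1 = Λ`, cf. file v5 §12), so only the CONSUMED
threshold is attained; the kernel instantiates `Λ = 1` and general `Λ` enters the reading through the gauge `c ↦ Λ·c`
only. (d) NOT CLAIMED: anything about Bałaban's actual step — whether the actual `Λhist·c♮` is small is the open wall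
W2-hist / W3 of the wall sheet exactly as before, and whether the actual step is "resonant" is not a question the census
asks (it reads exponents); the witnesses are two-line linear models, not field theories; constants are not census
currency.
-/

noncomputable section

open Metric Set Finset

namespace Literature.MathematicalPhysics.QuantumFieldTheory.Balaban1983to89.T4InputCauchyRateSharp

open Literature.MathematicalPhysics.QuantumFieldTheory.Balaban1983to89.T4OutputRate
open Literature.MathematicalPhysics.QuantumFieldTheory.Balaban1983to89.T4InputCauchyRate
open Literature.MathematicalPhysics.QuantumFieldTheory.Balaban1983to89.T4InputCauchyRateData
open Literature.MathematicalPhysics.QuantumFieldTheory.Balaban1983to89.T4InputCauchyRateSpecies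
open Literature.MathematicalPhysics.QuantumFieldTheory.Balaban1983to89.T4InputCauchyRateSecant

/-! ## §1 The witness family: geometric memory at damping `ω` with natural gain `c`, operators at rate `ω`, outputs
## `(ω + c)^k` -/

section Witness

/-- THE IDENTITY BEHIND THE WITNESS: `c·Σ_{j<k} ω^{k−1−j}(ω + c)^j = (ω + c)^k − ω^k` — the pure power `(ω + c)^k` solves
the discrepancy recursion `D_k = ω^k + c·Σ_{j<k} ω^{k−1−j}D_j` with EQUALITY. [folklore] -/
theorem mul_sharpSum (ω c : ℝ) (k : ℕ) :
    c * ∑ j ∈ range k, ω ^ (k - 1 - j) * (ω + c) ^ j = (ω + c) ^ k - ω ^ k := by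
  induction k with
  | zero => simp
  | succ n ih =>
    have hshift : ∑ j ∈ range n, ω ^ (n - j) * (ω + c) ^ j = ω * ∑ j ∈ range n, ω ^ (n - 1 - j) * (ω + c) ^ j := by
      rw [mul_sum]
      refine sum_congr rfl fun j hj => ?_
      have hjn := mem_range.1 hj
      obtain ⟨m, hm⟩ : ∃ m, n - j = m + 1 := ⟨n - 1 - j, by omega⟩
      rw [hm, show n - 1 - j = m by omega, pow_succ]
      ring
    rw [sum_range_succ, Nat.add_sub_cancel, Nat.sub_self, pow_zero, one_mul, hshift]
    linear_combination ω * ih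

/-- The run-A outputs of the witness: `(ω + c)^k` at a domain created at step `k`. [folklore] -/
def sharpEA (ω c : ℝ) : Functional toyCarriers toyCarriers.BgA := fun _ _ X => (ω + c) ^ toyCarriers.scale X

/-- The witness insertion at step `k`: the whole earlier table read with geometric memory, `c·Σ_{j<k} ω^{k−1−j}·t(j)` (real,
embedded in `ℂ`). [folklore] -/
def sharpIns (ω c : ℝ) (k : ℕ) (t : toyCarriers.Dom → ℝ) : ℂ := ((c * ∑ j ∈ range k, ω ^ (k - 1 - j) * t j : ℝ) : ℂ)

/-- The witness step model `sharpModel ω c`: `Out(o, h) = o + h`, operator data `ω^k` versus `0`, the same geometric-memory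
insertion for both runs, base class `{(0, 0)}`, unit margins. [folklore] -/
def sharpModel (ω c : ℝ) : StepModel toyCarriers ℂ ℂ where
  Out := fun _ o h _ => o + h
  opA := fun _ _ k => ((ω ^ k : ℝ) : ℂ)
  opB := fun _ _ _ => 0
  insA := fun _ _ k t => sharpIns ω c k t
  insB := fun _ _ k t => sharpIns ω c k t
  Base := fun _ _ _ => {p | p.1 = 0 ∧ p.2 = 0}
  rOp := fun _ => 1
  rHist := fun _ => 1
  rOp_pos := fun _ => one_pos
  rHist_pos := fun _ => one_pos

variable (ω c : ℝ)

/-- The insertion of run B's table (`≡ 0`) vanishes. [folklore] -/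
theorem sharpIns_tableB (g : ℕ → ℝ) (U : toyCarriers.BgB) (k : ℕ) : sharpIns ω c k (tableB toyEB g U) = 0 := by
  simp [sharpIns, tableB, toyEB]

/-- The insertion is linear in the table. [folklore] -/
theorem sharpIns_sub (k : ℕ) (t t' : toyCarriers.Dom → ℝ) :
    sharpIns ω c k (t - t') = sharpIns ω c k t - sharpIns ω c k t' := by
  rw [sharpIns, sharpIns, sharpIns, ← Complex.ofReal_sub, ← mul_sub, ← sum_sub_distrib]
  congr 3 with j
  rw [Pi.sub_apply, mul_sub]

end Witness

/-! ## §2 Every consumed hypothesis of the lineage's closures holds on the witness -/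

section Hypotheses

variable (ω c : ℝ)

/-- Run B (`≡ 0`) is represented. [folklore] -/
theorem sharp_representsB : (sharpModel ω c).RepresentsB toyEB Set.univ := by
  intro g _ U X
  show (0 : ℝ) = ((0 : ℂ) + sharpIns ω c (toyCarriers.scale X) (tableB toyEB g U)).re
  rw [sharpIns_tableB, add_zero, Complex.zero_re]

/-- Run A is represented — this IS the identity `mul_sharpSum`. [folklore] -/
theorem sharp_representsA : (sharpModel ω c).RepresentsA (sharpEA ω c) Set.univ := by
  intro g _ U X
  show (ω + c) ^ toyCarriers.scale X = (((ω ^ toyCarriers.scale X : ℝ) : ℂ) +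
    ((c * ∑ j ∈ range (toyCarriers.scale X), ω ^ (toyCarriers.scale X - 1 - j) * (ω + c) ^ j : ℝ) : ℂ)).re
  generalize toyCarriers.scale X = n
  rw [Complex.add_re, Complex.ofReal_re, Complex.ofReal_re, mul_sharpSum]
  ring

/-- Run B's data `(0, 0)` lie in the base class. [folklore] -/
theorem sharp_inBase : (sharpModel ω c).InBase toyEB Set.univ := by
  intro k g _ U
  show (sharpModel ω c).opB g U k = 0 ∧ sharpIns ω c k (tableB toyEB g U) = 0
  exact ⟨rfl, sharpIns_tableB ω c g U k⟩

/-- `o + h` is entire and bounded by `2` on the unit two-margin box around the base point `(0, 0)`. [folklore] -/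
theorem sharp_outputEnvelope : (sharpModel ω c).OutputEnvelope Set.univ 0 2 := by
  intro k g _ U p hp X _
  have hp' : p.1 = 0 ∧ p.2 = 0 := hp
  refine ⟨?_, ?_⟩
  · show DifferentiableOn ℂ (fun z : ℂ × ℂ => z.1 + z.2) _
    exact (differentiable_fst.add differentiable_snd).differentiableOn
  · intro z hz
    simp only [StepModel.box, Set.mem_prod, mem_closedBall, dist_eq_norm] at hz
    show ‖z.1 + z.2‖ ≤ 2 * Real.exp (-(0 * toyCarriers.d X))
    rw [zero_mul, neg_zero, Real.exp_zero, mul_one]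
    have h1 : ‖z.1‖ ≤ 1 := by
      have := hz.1
      rwa [hp'.1, sub_zero] at this
    have h2 : ‖z.2‖ ≤ 1 := by
      have := hz.2
      rwa [hp'.2, sub_zero] at this
    exact (norm_add_le _ _).trans (by linarith)

/-- The EXACT joint modulus: `DataLipschitz` with `Λ = 1` for EVERY reach `ρ₀`. [folklore] -/
theorem sharp_dataLipschitz (ρ₀ : ℝ) : (sharpModel ω c).DataLipschitz Set.univ 0 1 ρ₀ := by
  intro k g _ U p _ X _ q _ _
  show ‖(q.1 + q.2) - (p.1 + p.2)‖ ≤ 1 * (‖q.1 - p.1‖ / 1 + ‖q.2 - p.2‖ / 1) * Real.exp (-(0 * toyCarriers.d X))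
  rw [zero_mul, neg_zero, Real.exp_zero, mul_one, one_mul, div_one, div_one,
    show (q.1 + q.2) - (p.1 + p.2) = (q.1 - p.1) + (q.2 - p.2) by ring]
  exact norm_add_le _ _

/-- Hence the species form with `Λop = Λhist = 1`, every reach. [folklore] -/
theorem sharp_dataLipschitz₂ (ρ₀ : ℝ) : DataLipschitz₂ (sharpModel ω c) Set.univ 0 1 1 ρ₀ :=
  dataLipschitz₂_of_dataLipschitz (sharpModel ω c) (sharp_dataLipschitz ω c ρ₀)

/-- The EXACT operator leg: `OpLipschitz` with modulus `1`, every reach. [folklore] -/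
theorem sharp_opLipschitz (ρ₀ : ℝ) : OpLipschitz (sharpModel ω c) Set.univ 0 1 ρ₀ := by
  intro k g _ U p _ X _ o _
  show ‖(o + p.2) - (p.1 + p.2)‖ ≤ 1 * (‖o - p.1‖ / 1) * Real.exp (-(0 * toyCarriers.d X))
  rw [zero_mul, neg_zero, Real.exp_zero, mul_one, one_mul, div_one, add_sub_add_right_eq_sub]

/-- The EXACT class-wide history secant: `HistSecant K` with modulus `1` for EVERY class `K`. [folklore] -/
theorem sharp_histSecant (K : ℕ → (ℕ → ℝ) → toyCarriers.BgB → Set (ℂ × ℂ)) :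
    HistSecant (sharpModel ω c) K Set.univ 0 1 := by
  intro k g _ U o h h' _ _ X _
  show ‖(o + h') - (o + h)‖ ≤ 1 * (‖h' - h‖ / 1) * Real.exp (-(0 * toyCarriers.d X))
  rw [zero_mul, neg_zero, Real.exp_zero, mul_one, one_mul, div_one, add_sub_add_left_eq_sub]

/-- The history leg's endpoints lie in the universal class. [folklore] -/
theorem sharp_histPairInClass :
    HistPairInClass (sharpModel ω c) (fun _ _ _ => Set.univ) (sharpEA ω c) toyEB Set.univ :=
  fun _ _ _ _ => ⟨Set.mem_univ _, Set.mem_univ _⟩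

/-- One-run bound of run A with constant `1` (`0 ≤ ω + c ≤ 1`). [folklore] -/
theorem sharp_decayA (h0 : 0 ≤ ω + c) (h1 : ω + c ≤ 1) : DecayBound (sharpEA ω c) Set.univ 1 0 := by
  intro g _ U X
  show |(ω + c) ^ toyCarriers.scale X| ≤ 1 * Real.exp (-(0 * toyCarriers.d X))
  rw [zero_mul, neg_zero, Real.exp_zero, mul_one, abs_of_nonneg (pow_nonneg h0 _)]
  exact pow_le_one₀ h0 h1

/-- One-run bound of run B with constant `0`. [folklore] -/
theorem sharp_decayB : DecayBound toyEB Set.univ 0 0 := by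
  intro g _ U X
  show |(0 : ℝ)| ≤ 0 * Real.exp (-(0 * toyCarriers.d X))
  rw [abs_zero, zero_mul]

/-- Operator discrepancy `ω^k` = one margin times rate `ω^k`: operator rate `θ_op = ω` with equality. [folklore] -/
theorem sharp_operatorRate (hω : 0 ≤ ω) : (sharpModel ω c).OperatorRate Set.univ 1 ω := by
  intro k g _ U
  show ‖((ω ^ k : ℝ) : ℂ) - 0‖ ≤ 1 * ω ^ k * 1
  rw [sub_zero, Complex.norm_real, Real.norm_eq_abs, abs_of_nonneg (pow_nonneg hω _), one_mul, mul_one]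

/-- The two runs insert identically (`δ′ = 0`, any level, any rate). [folklore] -/
theorem sharp_insertionRate (E₀ θ : ℝ) : (sharpModel ω c).InsertionRate Set.univ 0 E₀ 0 θ := by
  intro k g _ U t _
  show ‖sharpIns ω c k t - sharpIns ω c k t‖ ≤ 0 * θ ^ k * 1
  rw [sub_self, norm_zero, zero_mul, zero_mul]

/-- The insertion is linear in the table. [folklore] -/
theorem sharp_insLinear : (sharpModel ω c).InsLinear Set.univ := fun k _ _ _ t t' => sharpIns_sub ω c k t t'

/-- Hence affine. [folklore] -/
theorem sharp_insAffine : (sharpModel ω c).InsAffine Set.univ :=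
  (sharpModel ω c).insAffine_of_linear (sharp_insLinear ω c)

/-- The damped-Lipschitz insertion bound in the printed age normalisation, natural gain `c`, damping `ω`:
`‖ins_k(t) − ins_k(t′)‖ ≤ c·Σ_{j<k} ω^{k−1−j}·D_j` for tables `D`-close below scale `k`. [folklore] -/
theorem sharp_insertionDampedNat (hω : 0 ≤ ω) (hc : 0 ≤ c) : (sharpModel ω c).InsertionDampedNat Set.univ 0 c ω := by
  intro k g _ U t t' D hD ht
  show ‖sharpIns ω c k t - sharpIns ω c k t'‖ ≤ 1 * (c * ∑ j ∈ range k, ω ^ (k - 1 - j) * D j)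
  rw [← sharpIns_sub, sharpIns, Complex.norm_real, Real.norm_eq_abs, one_mul, abs_mul, abs_of_nonneg hc]
  refine mul_le_mul_of_nonneg_left ((abs_sum_le_sum_abs _ _).trans (sum_le_sum fun j hj => ?_)) hc
  rw [abs_mul, abs_of_nonneg (pow_nonneg hω _)]
  refine mul_le_mul_of_nonneg_left ?_ (pow_nonneg hω _)
  have := ht j (mem_range.1 hj)
  rwa [zero_mul, neg_zero, Real.exp_zero, mul_one] at this

end Hypotheses

/-! ## §3 The NE5 rates of the witness are EXACTLY `[ω + c, ∞)`: the closures fire down to the threshold, NE5 holds at it,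
## and fails below it for every constant -/

section Sharp

variable {ω c θ' : ℝ}

/-- **THE LIPSCHITZ-FACED CLOSURE FIRES DOWN TO THE THRESHOLD**: for every `θ′ ∈ (ω + c, 1]`, file v5's
`ne5_at_of_stepModel_lip_nat` applies to the witness (`Λ = 1`, `δ = 1`, `δ′ = 0`, `θ = ω`, reach `ρ₀ = 1 + c/(1 − ω)` from
the first scale, `k₀ = 0`, `B = 0`; smallness `ω + 1·c < θ′`). [folklore] -/
theorem sharp_ne5_lip (hω : 0 < ω) (hc : 0 ≤ c) (hθ' : ω + c < θ') (hθ'1 : θ' ≤ 1) :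
    NE5 (sharpEA ω c) toyEB (Set.univ : Set (ℕ → ℝ)) 0 θ' ((1 * (1 + 0) + 0) * (θ' - ω) / (θ' - (ω + 1 * c))) :=
  (sharpModel ω c).ne5_at_of_stepModel_lip_nat (ρ₀ := 1 + c / (1 - ω)) (B := 0) (k₀ := 0) (sharp_representsA ω c)
    (sharp_representsB ω c) (sharp_inBase ω c) (sharp_dataLipschitz ω c _) (sharp_decayA ω c (by linarith) (by linarith))
    sharp_decayB (sharp_operatorRate ω c hω.le) (sharp_insertionRate ω c 0 ω) (sharp_insertionDampedNat ω c hω.le hc)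
    zero_le_one (by norm_num) hω.le (by linarith) hθ'1 hc hω (by norm_num) le_rfl
    (fun k hk => absurd hk (Nat.not_lt_zero k)) (by linarith)

/-- **THE SECANT-FACED CLOSURE FIRES DOWN TO THE THRESHOLD**: for every `θ′ ∈ (ω + c, 1]`, `T4InputCauchyRateSecant`'s
`ne5_at_of_stepModel_secant_nat` applies to the witness (universal class, `Λop = Λhist = 1`, operator reach `1`, `k₀ = 0`,
`B = 0`; smallness `ω + 1·c < θ′`). [folklore] -/
theorem sharp_ne5_secant (hω : 0 < ω) (hc : 0 ≤ c) (hθ' : ω + c < θ') (hθ'1 : θ' ≤ 1) :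
    NE5 (sharpEA ω c) toyEB (Set.univ : Set (ℕ → ℝ)) 0 θ' ((1 * 1 + 1 * 0 + 0) * (θ' - ω) / (θ' - (ω + 1 * c))) :=
  ne5_at_of_stepModel_secant_nat (sharpModel ω c) (K := fun _ _ _ => Set.univ) (ρ₀ := 1) (B := 0) (k₀ := 0)
    (sharp_representsA ω c) (sharp_representsB ω c) (sharp_inBase ω c) (sharp_histPairInClass ω c)
    (sharp_opLipschitz ω c 1) (sharp_histSecant ω c _) (sharp_decayA ω c (by linarith) (by linarith)) sharp_decayB
    (sharp_operatorRate ω c hω.le) (sharp_insertionRate ω c 0 ω) (sharp_insertionDampedNat ω c hω.le hc) zero_le_one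
    zero_le_one zero_le_one le_rfl hω.le (by linarith) hθ'1 hc hω (by norm_num) le_rfl
    (fun k hk => absurd hk (Nat.not_lt_zero k)) (by linarith)

/-- **NE5 HOLDS AT AND ABOVE THE THRESHOLD** with constant `1` (`(ω + c)^k ≤ θ′^k`). [folklore] -/
theorem sharp_ne5_of_le (h0 : 0 ≤ ω + c) (hθ' : ω + c ≤ θ') :
    NE5 (sharpEA ω c) toyEB (Set.univ : Set (ℕ → ℝ)) 0 θ' 1 := by
  intro g _ U X
  show |(ω + c) ^ toyCarriers.scale X - 0| ≤ 1 * θ' ^ toyCarriers.scale X * Real.exp (-(0 * toyCarriers.d X))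
  rw [sub_zero, zero_mul, neg_zero, Real.exp_zero, mul_one, one_mul, abs_of_nonneg (pow_nonneg h0 _)]
  exact pow_le_pow_left₀ h0 hθ' _

/-- **NE5 FAILS BELOW THE THRESHOLD FOR EVERY CONSTANT**: for `θ′ < ω + c` (`0 < ω + c`) no `C₅` gives
`NE5 (sharpEA ω c) toyEB univ 0 θ′ C₅`. [folklore] -/
theorem sharp_not_ne5_of_lt (hr : 0 < ω + c) (hθ' : θ' < ω + c) (C₅ : ℝ) :
    ¬ NE5 (sharpEA ω c) toyEB (Set.univ : Set (ℕ → ℝ)) 0 θ' C₅ := by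
  intro h
  have hk : ∀ k : ℕ, (ω + c) ^ k ≤ C₅ * θ' ^ k := fun k => by
    have e : |(ω + c) ^ k - 0| ≤ C₅ * θ' ^ k * Real.exp (-(0 * (0 : ℝ))) := h (fun _ => 1) (Set.mem_univ _) () k
    rwa [sub_zero, zero_mul, neg_zero, Real.exp_zero, mul_one, abs_of_nonneg (pow_nonneg hr.le _)] at e
  rcases le_or_gt θ' 0 with hle | hpos
  · have h1 := hk 1
    have h2 := hk 2
    rw [pow_one, pow_one] at h1
    nlinarith [mul_nonneg (by linarith : (0 : ℝ) ≤ C₅ * θ' - (ω + c)) (by linarith : (0 : ℝ) ≤ -θ'), pow_pos hr 2]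
  · have hq : 1 < (ω + c) / θ' := by rw [lt_div_iff₀ hpos]; linarith
    obtain ⟨k, hkC⟩ := pow_unbounded_of_one_lt C₅ hq
    rw [div_pow, lt_div_iff₀ (pow_pos hpos k)] at hkC
    linarith [hk k]

/-- **THE RATE SET OF THE WITNESS IS EXACTLY `{θ′ | ω + c ≤ θ′}`** (`0 < ω + c`). [folklore] -/
theorem sharp_ne5_iff (hr : 0 < ω + c) (θ' : ℝ) :
    (∃ C₅, NE5 (sharpEA ω c) toyEB (Set.univ : Set (ℕ → ℝ)) 0 θ' C₅) ↔ ω + c ≤ θ' :=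
  ⟨fun ⟨C₅, h⟩ => not_lt.1 fun hlt => sharp_not_ne5_of_lt hr hlt C₅ h, fun h => ⟨1, sharp_ne5_of_le hr.le h⟩⟩

/-- **THE RATE LOSS THROUGH THE HISTORY FEED IS REAL**: with a genuine feed (`c > 0`) the outputs do NOT converge at the
rate `ω` of the step's inputs (operators at rate `ω`, insertions identical), for any constant. [folklore] -/
theorem sharp_not_ne5_at_input_rate (hω : 0 ≤ ω) (hc : 0 < c) (C₅ : ℝ) :
    ¬ NE5 (sharpEA ω c) toyEB (Set.univ : Set (ℕ → ℝ)) 0 ω C₅ :=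
  sharp_not_ne5_of_lt (by linarith) (by linarith) C₅

/-- **TWO-SIDEDNESS OF THE CONSUMED SMALLNESS, in one statement**: for every damping `0 < ω` and natural gain `0 ≤ c`
there is a pair of runs on which (α) the closures fire at every `θ′ ∈ (ω + c, 1]` (the Lipschitz face shown; the secant
face is `sharp_ne5_secant`) and (β) NE5 fails at every `θ′ < ω + c` for every constant. [folklore] -/
theorem smallness_two_sided (hω : 0 < ω) (hc : 0 ≤ c) :
    (∀ θ', ω + c < θ' → θ' ≤ 1 → ∃ C₅, NE5 (sharpEA ω c) toyEB (Set.univ : Set (ℕ → ℝ)) 0 θ' C₅) ∧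
      ∀ θ', θ' < ω + c → ∀ C₅, ¬ NE5 (sharpEA ω c) toyEB (Set.univ : Set (ℕ → ℝ)) 0 θ' C₅ :=
  ⟨fun _ hθ' hθ'1 => ⟨_, sharp_ne5_lip hω hc hθ' hθ'1⟩, fun _ hθ' C₅ => sharp_not_ne5_of_lt (by linarith) hθ' C₅⟩

end Sharp

/-! ## §4 The numbers at `ω = 1/2`, `c = 1/4`: threshold `3/4`, inputs at rate `1/2` -/

section Numbers

/-- At `ω = 1/2`, `c = 1/4`: both closures fire at every `θ′ ∈ (3/4, 1]`, NE5 holds at `3/4` with constant `1`, and fails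
at every `θ′ < 3/4` — in particular at the input rate `1/2` — for every constant. [folklore] -/
theorem sharp_three_quarters :
    (∀ θ' : ℝ, 3 / 4 < θ' → θ' ≤ 1 →
      NE5 (sharpEA (1 / 2) (1 / 4)) toyEB (Set.univ : Set (ℕ → ℝ)) 0 θ'
        ((1 * (1 + 0) + 0) * (θ' - 1 / 2) / (θ' - (1 / 2 + 1 * (1 / 4))))) ∧
    NE5 (sharpEA (1 / 2) (1 / 4)) toyEB (Set.univ : Set (ℕ → ℝ)) 0 (3 / 4) 1 ∧
    (∀ θ' : ℝ, θ' < 3 / 4 → ∀ C₅, ¬ NE5 (sharpEA (1 / 2) (1 / 4)) toyEB (Set.univ : Set (ℕ → ℝ)) 0 θ' C₅) ∧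
    ∀ C₅, ¬ NE5 (sharpEA (1 / 2) (1 / 4)) toyEB (Set.univ : Set (ℕ → ℝ)) 0 (1 / 2) C₅ := by
  refine ⟨fun θ' h h1 => sharp_ne5_lip (by norm_num) (by norm_num) (by norm_num; exact h) h1,
    sharp_ne5_of_le (by norm_num) (by norm_num), fun θ' h => sharp_not_ne5_of_lt (by norm_num) (by norm_num; exact h),
    sharp_not_ne5_at_input_rate (by norm_num) (by norm_num)⟩

/-- [analysis] The numbers: threshold `1/2 + 1·(1/4) = 3/4 > 1/2` (the input rate); the closures' constant
`(θ′ − 1/2)/(θ′ − 3/4)` is `2` at `θ′ = 1` and `6` at `θ′ = 4/5`, against the true constant `1`. [folklore] -/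
example : (1 : ℝ) / 2 + 1 * (1 / 4) = 3 / 4 ∧ (1 : ℝ) / 2 < 3 / 4 ∧
    ((1 : ℝ) * (1 + 0) + 0) * (1 - 1 / 2) / (1 - (1 / 2 + 1 * (1 / 4))) = 2 ∧
    ((1 : ℝ) * (1 + 0) + 0) * (4 / 5 - 1 / 2) / (4 / 5 - (1 / 2 + 1 * (1 / 4))) = 6 := by norm_num

end Numbers


/-! ## §5 (file v1.1, ADDITIVE) The renewal recursion solved EXACTLY: below resonance the threshold rate `(1 + b)ω`
## itself is ATTAINED with a `k`-uniform constant and NO smallness hypothesis; at resonance the budget is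
## `A(1 + k·b/(1 + b))((1 + b)ω)^k` -/

section Renewal

/-- Splitting off the newest scale: `Σ_{j<k+1} ω^{k−j}E_j = ω·Σ_{j<k} ω^{k−1−j}E_j + E_k`. [folklore] -/
theorem sum_age_succ (ω : ℝ) (E : ℕ → ℝ) (k : ℕ) :
    ∑ j ∈ range (k + 1), ω ^ (k - j) * E j = ω * ∑ j ∈ range k, ω ^ (k - 1 - j) * E j + E k := by
  rw [sum_range_succ, Nat.sub_self, pow_zero, one_mul, mul_sum]
  congr 1
  refine sum_congr rfl fun j hj => ?_
  have hjk := mem_range.1 hj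
  obtain ⟨m, hm⟩ : ∃ m, k - j = m + 1 := ⟨k - 1 - j, by omega⟩
  rw [hm, show k - 1 - j = m by omega, pow_succ]
  ring

/-- The history weights `b·ω^{k−j}` of `RecursiveRate` (true age `k − j ≥ 1` under `j < k`) are `bω` times the natural-age
weights `ω^{k−1−j}`. [folklore] -/
theorem sum_weight_eq (b ω : ℝ) (D : ℕ → ℝ) (k : ℕ) :
    ∑ j ∈ range k, b * ω ^ (k - j) * D j = b * ω * ∑ j ∈ range k, ω ^ (k - 1 - j) * D j := by
  rw [mul_sum]
  refine sum_congr rfl fun j hj => ?_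
  have hjk := mem_range.1 hj
  obtain ⟨m, hm⟩ : ∃ m, k - j = m + 1 := ⟨k - 1 - j, by omega⟩
  rw [hm, show k - 1 - j = m by omega, pow_succ]
  ring

/-- **THE RENEWAL IDENTITY.** A sequence with `E_0 = A` obeying the FIRST-ORDER recursion
`E_{k+1} = (ω + β)E_k + Aθ^k(θ − ω)` solves the FULL-HISTORY recursion `E_k = Aθ^k + β·Σ_{j<k} ω^{k−1−j}E_j` with EQUALITY
at every scale (subtract `ω` times the identity at `k` from the identity at `k + 1`). [folklore] -/
theorem renewal_identity {θ ω β A : ℝ} {E : ℕ → ℝ} (h0 : E 0 = A)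
    (hstep : ∀ k, E (k + 1) = (ω + β) * E k + A * θ ^ k * (θ - ω)) (k : ℕ) :
    A * θ ^ k + β * ∑ j ∈ range k, ω ^ (k - 1 - j) * E j = E k := by
  induction k with
  | zero => simp [h0]
  | succ n ih =>
    rw [Nat.add_sub_cancel, sum_age_succ, hstep n, pow_succ]
    linear_combination ω * ih

/-- **THE RESONANT SEQUENCE IS DOMINATED JUST ABOVE RESONANCE**: `(1 + k·c/r)·r^k ≤ (1 + c/(θ′ − r))·θ′^k` for
`0 < r < θ′`, `0 ≤ c` (from `k·q^k ≤ Σ_{1≤i≤k} q^i ≤ q/(1 − q)`, `q = r/θ′`). [folklore] -/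
theorem resSeq_le {r c θ' : ℝ} (hr : 0 < r) (hc : 0 ≤ c) (hθ' : r < θ') (k : ℕ) :
    (1 + k * c / r) * r ^ k ≤ (1 + c / (θ' - r)) * θ' ^ k := by
  have hθ'0 : 0 < θ' := hr.trans hθ'
  have hθ'k : 0 < θ' ^ k := pow_pos hθ'0 k
  set q := r / θ' with hq
  have hq0 : 0 < q := div_pos hr hθ'0
  have hq1 : q < 1 := (div_lt_one hθ'0).2 hθ'
  have hkq : (k : ℝ) * q ^ k ≤ q / (1 - q) :=
    calc (k : ℝ) * q ^ k = ∑ _j ∈ range k, q ^ k := by rw [sum_const, card_range, nsmul_eq_mul]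
      _ ≤ ∑ j ∈ range k, q ^ (k - j) :=
          sum_le_sum fun j _ => pow_le_pow_of_le_one hq0.le hq1.le (Nat.sub_le k j)
      _ ≤ q / (1 - q) := sum_pow_age_le hq0.le hq1 k
  have hrk : r ^ k = q ^ k * θ' ^ k := by rw [hq, div_pow, div_mul_cancel₀ _ hθ'k.ne']
  have hqq : q / (1 - q) = r / (θ' - r) := by
    rw [hq]
    field_simp
  rw [hrk, ← mul_assoc]
  refine mul_le_mul_of_nonneg_right ?_ hθ'k.le
  have hqk1 : q ^ k ≤ 1 := pow_le_one₀ hq0.le hq1.le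
  have hcr : 0 ≤ c / r := div_nonneg hc hr.le
  calc (1 + k * c / r) * q ^ k = q ^ k + c / r * (k * q ^ k) := by ring
    _ ≤ 1 + c / r * (q / (1 - q)) := add_le_add hqk1 (mul_le_mul_of_nonneg_left hkq hcr)
    _ = 1 + c / (θ' - r) := by rw [hqq, div_mul_div_comm, mul_comm c r, mul_div_mul_left _ _ hr.ne']

end Renewal

section Threshold

variable {C : Carriers} {EA : Functional C C.BgA} {EB : Functional C C.BgB} {W : Set (ℕ → ℝ)} {κ θ ω A b : ℝ}

/-- A larger constant is still an NE5 constant (`0 ≤ θ′`). [folklore] -/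
theorem ne5_mono_const {θ' C₅ C₅' : ℝ} (h : NE5 EA EB W κ θ' C₅) (hθ' : 0 ≤ θ') (hC : C₅ ≤ C₅') :
    NE5 EA EB W κ θ' C₅' := by
  rw [ne5_iff_boundedAtScale] at h ⊢
  exact fun j => boundedAtScale_mono (h j) (mul_le_mul_of_nonneg_right hC (pow_nonneg hθ' j))

/-- A nonnegative EXACT SOLUTION of the renewal recursion (`E_0 = A`, `E_{k+1} = (ω + bω)E_k + Aθ^k(θ − ω)`) bounds the
discrepancies scale by scale under `RecursiveRate … θ ω A b` — strong induction, the recursion's right side being the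
full-history form `Aθ^k + Σ_{j<k} bω^{k−j}E_j = E_k` (`renewal_identity`). [folklore] -/
theorem boundedAtScale_of_solution (h : RecursiveRate EA EB W κ θ ω A b) {E : ℕ → ℝ} (hE : ∀ k, 0 ≤ E k)
    (h0 : E 0 = A) (hstep : ∀ k, E (k + 1) = (ω + b * ω) * E k + A * θ ^ k * (θ - ω)) (k : ℕ) :
    BoundedAtScale EA EB W κ k (E k) := by
  induction k using Nat.strong_induction_on with
  | _ k ih =>
    have hk := h k E fun j hj => ⟨hE j, ih j hj⟩
    rwa [sum_weight_eq, renewal_identity h0 hstep] at hk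

/-- **THE THRESHOLD RATE IS ATTAINED — input at or above the damping, strictly below the threshold.**  If the recursive
budget holds with `0 ≤ A, b, ω` and the input rate satisfies `ω ≤ θ < (1 + b)ω`, then NE5 holds AT the rate `(1 + b)ω`
with the `k`-UNIFORM constant `A·bω/((1 + b)ω − θ)` — NO smallness hypothesis.  The exact solution is
`E_k = A[bω·((1 + b)ω)^k − (θ − ω)θ^k]/((1 + b)ω − θ)`; the constant is `sup_k E_k/((1 + b)ω)^k`. [folklore] -/
theorem ne5_threshold_of_recursiveRate (hA : 0 ≤ A) (hb : 0 ≤ b) (hω : 0 ≤ ω) (hωθ : ω ≤ θ)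
    (hθr : θ < (1 + b) * ω) (h : RecursiveRate EA EB W κ θ ω A b) :
    NE5 EA EB W κ ((1 + b) * ω) (A * (b * ω) / ((1 + b) * ω - θ)) := by
  have hden : 0 < (1 + b) * ω - θ := sub_pos.2 hθr
  have hne : (1 + b) * ω - θ ≠ 0 := hden.ne'
  have hθ : 0 ≤ θ := hω.trans hωθ
  have hr : 0 ≤ (1 + b) * ω := mul_nonneg (by linarith) hω
  set K₁ := A * (b * ω) / ((1 + b) * ω - θ) with hK₁
  set K₂ := A * (θ - ω) / ((1 + b) * ω - θ) with hK₂
  have hK₂0 : 0 ≤ K₂ := div_nonneg (mul_nonneg hA (sub_nonneg.2 hωθ)) hden.le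
  have hK₂₁ : K₂ ≤ K₁ :=
    div_le_div_of_nonneg_right (mul_le_mul_of_nonneg_left (by linarith) hA) hden.le
  have hK₁0 : 0 ≤ K₁ := hK₂0.trans hK₂₁
  -- the two identities defining the exact solution `K₁((1 + b)ω)^k − K₂θ^k`
  have h0 : K₁ - K₂ = A := by
    rw [hK₁, hK₂, div_sub_div_same, div_eq_iff hne]
    ring
  have hK₂' : K₂ * ((1 + b) * ω - θ) = A * (θ - ω) := by
    rw [hK₂, div_mul_cancel₀ _ hne]
  have hsol := boundedAtScale_of_solution h (E := fun k => K₁ * ((1 + b) * ω) ^ k - K₂ * θ ^ k)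
    (fun k => sub_nonneg.2 ((mul_le_mul_of_nonneg_right hK₂₁ (pow_nonneg hθ k)).trans
      (mul_le_mul_of_nonneg_left (pow_le_pow_left₀ hθ hθr.le k) hK₁0)))
    (by rw [pow_zero, pow_zero, mul_one, mul_one, h0]) (fun k => by linear_combination θ ^ k * hK₂')
  rw [ne5_iff_boundedAtScale]
  intro k
  exact boundedAtScale_mono (hsol k) (sub_le_self _ (mul_nonneg hK₂0 (pow_nonneg hθ k)))

/-- **THE THRESHOLD RATE IS ATTAINED — input at or below the damping.**  If the recursive budget holds with `0 ≤ A, b` and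
`0 ≤ θ ≤ ω`, then NE5 holds at the rate `(1 + b)ω` with the operator constant `A` itself (exact solution at `θ = ω`:
`E_k = A((1 + b)ω)^k`, cf. `mul_sharpSum`). [folklore] -/
theorem ne5_threshold_of_recursiveRate_of_le (hA : 0 ≤ A) (hb : 0 ≤ b) (hθ : 0 ≤ θ) (hθω : θ ≤ ω)
    (h : RecursiveRate EA EB W κ θ ω A b) : NE5 EA EB W κ ((1 + b) * ω) A := by
  have hω : 0 ≤ ω := hθ.trans hθω
  have hr : 0 ≤ (1 + b) * ω := mul_nonneg (by linarith) hω
  have hsol := boundedAtScale_of_solution (recursiveRate_mono_rate hA hθ hθω h)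
    (E := fun k => A * ((1 + b) * ω) ^ k) (fun k => mul_nonneg hA (pow_nonneg hr k)) (by simp)
    (fun k => by ring)
  rw [ne5_iff_boundedAtScale]
  exact hsol

/-- **THE THRESHOLD RATE IS ATTAINED, in one statement**: `0 ≤ θ < (1 + b)ω` and the recursive budget give NE5 at
`(1 + b)ω` with constant `A·max(1, bω/((1 + b)ω − θ))` (`= A` for `θ ≤ ω`, `= A·bω/((1 + b)ω − θ)` for `θ ≥ ω`).
The geometric-series closure `ne5_of_recursiveRate` (file v1) needs `(1 + b)ω < θ′` and its constant tends to `∞` at the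
threshold; the exact solution shows that loss is an artefact of that proof — OFF resonance. [folklore] -/
theorem ne5_threshold_of_recursiveRate' (hA : 0 ≤ A) (hb : 0 ≤ b) (hω : 0 ≤ ω) (hθ : 0 ≤ θ)
    (hθr : θ < (1 + b) * ω) (h : RecursiveRate EA EB W κ θ ω A b) :
    NE5 EA EB W κ ((1 + b) * ω) (A * max 1 (b * ω / ((1 + b) * ω - θ))) := by
  have hr : 0 ≤ (1 + b) * ω := mul_nonneg (by linarith) hω
  rcases le_total θ ω with hθω | hωθ
  · exact ne5_mono_const (ne5_threshold_of_recursiveRate_of_le hA hb hθ hθω h) hr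
      (le_mul_of_one_le_right hA (le_max_left _ _))
  · exact ne5_mono_const (ne5_threshold_of_recursiveRate hA hb hω hωθ hθr h) hr
      (by rw [mul_div_assoc]; exact mul_le_mul_of_nonneg_left (le_max_right _ _) hA)

/-- **AT RESONANCE** (input rate EQUAL to the threshold, `θ = (1 + b)ω`) the exact solution is
`E_k = A(1 + k·b/(1 + b))((1 + b)ω)^k`: the discrepancies are bounded scale by scale by a LINEARLY GROWING multiple of the
threshold power — so NE5 holds at every `θ′ > (1 + b)ω` (file v1; `resSeq_le`) but no `k`-uniform constant at the
threshold follows, and none exists in general (`res_not_ne5_of_le` below). [folklore] -/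
theorem boundedAtScale_resonance_of_recursiveRate (hA : 0 ≤ A) (hb : 0 ≤ b) (hω : 0 ≤ ω)
    (h : RecursiveRate EA EB W κ ((1 + b) * ω) ω A b) (k : ℕ) :
    BoundedAtScale EA EB W κ k (A * (1 + k * b / (1 + b)) * ((1 + b) * ω) ^ k) := by
  have h1b : (1 + b) ≠ 0 := by positivity
  have hr : 0 ≤ (1 + b) * ω := mul_nonneg (by linarith) hω
  exact boundedAtScale_of_solution h (E := fun k : ℕ => A * (1 + k * b / (1 + b)) * ((1 + b) * ω) ^ k)
    (fun k => mul_nonneg (mul_nonneg hA (by positivity)) (pow_nonneg hr k)) (by simp)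
    (fun k => by simp only [Nat.cast_succ]; field_simp; ring) k

/-- **THE RATE DECISION OFF RESONANCE**: for `θ ≠ (1 + b)ω` the recursive budget gives NE5 AT the rate `max(θ, (1 + b)ω)`
(below the threshold by `ne5_threshold_of_recursiveRate'`, above it by file v1's `ne5_of_recursiveRate`). [folklore] -/
theorem ne5_at_max_of_recursiveRate (hA : 0 ≤ A) (hb : 0 ≤ b) (hω : 0 ≤ ω) (hθ : 0 ≤ θ) (hres : θ ≠ (1 + b) * ω)
    (h : RecursiveRate EA EB W κ θ ω A b) : ∃ C₅, NE5 EA EB W κ (max θ ((1 + b) * ω)) C₅ := by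
  rcases lt_or_gt_of_ne hres with hlt | hgt
  · rw [max_eq_right hlt.le]
    exact ⟨_, ne5_threshold_of_recursiveRate' hA hb hω hθ hlt h⟩
  · rw [max_eq_left hgt.le]
    exact ⟨_, ne5_of_recursiveRate hA hb hω hgt h⟩

/-- … and STRICTLY ABOVE `max(θ, (1 + b)ω)` NE5 holds unconditionally (resonance included; file v5's
`ne5_at_of_recursiveRate`). [folklore] -/
theorem ne5_above_max_of_recursiveRate (hA : 0 ≤ A) (hb : 0 ≤ b) (hω : 0 ≤ ω) (hθ : 0 ≤ θ)
    (h : RecursiveRate EA EB W κ θ ω A b) {θ' : ℝ} (hθ' : max θ ((1 + b) * ω) < θ') :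
    ∃ C₅, NE5 EA EB W κ θ' C₅ :=
  ⟨_, ne5_at_of_recursiveRate hA hb hω hθ (le_of_max_le_left hθ'.le) (max_lt_iff.1 hθ').2 h⟩

end Threshold

/-! ## §6 (file v1.1, ADDITIVE) The two consumed faces AT the threshold `ω + Λ·c`: input rate strictly below it suffices -/

section Faces

variable {C : Carriers} {Op Hist : Type*} [NormedAddCommGroup Op] [NormedSpace ℂ Op] [NormedAddCommGroup Hist]
  [NormedSpace ℂ Hist]

/-- **THE LIPSCHITZ-FACED CLOSURE AT THE THRESHOLD** (file v5's `StepModel.ne5_at_of_stepModel_lip_nat` with its smallness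
`ω + Λ·c < θ′` replaced by `θ < ω + Λ·c` — the input rate strictly below the threshold — and the conclusion AT
`θ′ = ω + Λ·c`): constant `(Λ(δ + δ′) + B)·max(1, Λc/(ω + Λc − θ))`.  Same hypotheses otherwise (`ω < 1` explicit, as it no
longer follows from `θ′ ≤ 1`). [folklore] -/
theorem ne5_threshold_of_stepModel_lip_nat (M : StepModel C Op Hist) {EA : Functional C C.BgA}
    {EB : Functional C C.BgB} {W : Set (ℕ → ℝ)} {κ Λ EA₀ E₀ δ δ' θ c ω ρ₀ B : ℝ} {k₀ : ℕ}
    (hrA : M.RepresentsA EA W) (hrB : M.RepresentsB EB W) (hbase : M.InBase EB W) (hlip : M.DataLipschitz W κ Λ ρ₀)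
    (hdA : DecayBound EA W EA₀ κ) (hdB : DecayBound EB W E₀ κ) (hop : M.OperatorRate W δ θ)
    (hins : M.InsertionRate W κ E₀ δ' θ) (hdamp : M.InsertionDampedNat W κ c ω) (hΛ : 0 ≤ Λ) (hδ : 0 ≤ δ + δ')
    (hθ : 0 ≤ θ) (hθ1 : θ ≤ 1) (hc : 0 ≤ c) (hω : 0 < ω) (hω1 : ω < 1)
    (hnear : (δ + δ') * θ ^ k₀ + c * (EA₀ + E₀) / (1 - ω) ≤ ρ₀) (hB : 0 ≤ B)
    (hfirst : ∀ k < k₀, EA₀ + E₀ ≤ B * θ ^ k) (hsub : θ < ω + Λ * c) :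
    NE5 EA EB W κ (ω + Λ * c) ((Λ * (δ + δ') + B) * max 1 (Λ * c / (ω + Λ * c - θ))) := by
  have h1 : (1 + Λ * (c / ω)) * ω = ω + Λ * c := by
    rw [add_mul, one_mul, mul_assoc Λ, div_mul_cancel₀ c hω.ne']
  have h3 : Λ * (c / ω) * ω = Λ * c := by rw [mul_assoc, div_mul_cancel₀ c hω.ne']
  have h2 : c / ω * (EA₀ + E₀) * (ω / (1 - ω)) = c * (EA₀ + E₀) / (1 - ω) := by
    rw [← mul_div_assoc, div_mul_eq_mul_div, div_mul_cancel₀ _ hω.ne']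
  have hrec := M.recursiveRate_of_stepModel_lip hrA hrB hbase hlip hdA hdB hop hins (M.insertionDamped_of_nat hdamp hω)
    hΛ hδ hθ hθ1 (div_nonneg hc hω.le) hω.le hω1 (by rw [h2]; exact hnear) hB hfirst
  have key := ne5_threshold_of_recursiveRate' (add_nonneg (mul_nonneg hΛ hδ) hB)
    (mul_nonneg hΛ (div_nonneg hc hω.le)) hω.le hθ (by rw [h1]; exact hsub) hrec
  rwa [h1, h3] at key

/-- **THE SECANT-FACED CLOSURE AT THE THRESHOLD** (`T4InputCauchyRateSecant.ne5_at_of_stepModel_secant_nat` with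
`ω + Λhist·c < θ′` replaced by `θ < ω + Λhist·c` and the conclusion AT `θ′ = ω + Λhist·c`): constant
`(Λop·δ + Λhist·δ′ + B)·max(1, Λhist·c/(ω + Λhist·c − θ))`. [folklore] -/
theorem ne5_threshold_of_stepModel_secant_nat (M : StepModel C Op Hist)
    {K : ℕ → (ℕ → ℝ) → C.BgB → Set (Op × Hist)} {EA : Functional C C.BgA} {EB : Functional C C.BgB}
    {W : Set (ℕ → ℝ)} {κ Λop Λhist EA₀ E₀ δ δ' θ c ω ρ₀ B : ℝ} {k₀ : ℕ} (hrA : M.RepresentsA EA W)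
    (hrB : M.RepresentsB EB W) (hbase : M.InBase EB W) (hpair : HistPairInClass M K EA EB W)
    (hopL : OpLipschitz M W κ Λop ρ₀) (hsec : HistSecant M K W κ Λhist) (hdA : DecayBound EA W EA₀ κ)
    (hdB : DecayBound EB W E₀ κ) (hop : M.OperatorRate W δ θ) (hins : M.InsertionRate W κ E₀ δ' θ)
    (hdamp : M.InsertionDampedNat W κ c ω) (hΛop : 0 ≤ Λop) (hΛhist : 0 ≤ Λhist) (hδ : 0 ≤ δ) (hδ' : 0 ≤ δ')
    (hθ : 0 ≤ θ) (hθ1 : θ ≤ 1) (hc : 0 ≤ c) (hω : 0 < ω) (hreach : δ * θ ^ k₀ ≤ ρ₀) (hB : 0 ≤ B)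
    (hfirst : ∀ k < k₀, EA₀ + E₀ ≤ B * θ ^ k) (hsub : θ < ω + Λhist * c) :
    NE5 EA EB W κ (ω + Λhist * c) ((Λop * δ + Λhist * δ' + B) * max 1 (Λhist * c / (ω + Λhist * c - θ))) := by
  have h1 : (1 + Λhist * (c / ω)) * ω = ω + Λhist * c := by
    rw [add_mul, one_mul, mul_assoc Λhist, div_mul_cancel₀ c hω.ne']
  have h3 : Λhist * (c / ω) * ω = Λhist * c := by rw [mul_assoc, div_mul_cancel₀ c hω.ne']
  have hrec := recursiveRate_of_stepModel_secant M hrA hrB hbase hpair hopL hsec hdA hdB hop hins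
    (M.insertionDamped_of_nat hdamp hω) hΛop hΛhist hδ hδ' hθ hθ1 (div_nonneg hc hω.le) hω.le hreach hB hfirst
  have key := ne5_threshold_of_recursiveRate'
    (add_nonneg (add_nonneg (mul_nonneg hΛop hδ) (mul_nonneg hΛhist hδ')) hB)
    (mul_nonneg hΛhist (div_nonneg hc hω.le)) hω.le hθ (by rw [h1]; exact hsub) hrec
  rwa [h1, h3] at key

end Faces

/-! ## §7 (file v1.1, ADDITIVE) The general closure is EXACT on the witness of §1 (constant `1` AT `ω + c`), and the
## RESONANT witness (`θ_op = ω + c`): every consumed hypothesis holds, NE5 fails AT the threshold, holds strictly above -/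

section Exact

variable {ω c : ℝ}

/-- **THE THRESHOLD CLOSURE IS EXACT ON THE WITNESS OF §1**: `ne5_threshold_of_stepModel_lip_nat` applied to
`sharpModel ω c` (`θ_op = ω < ω + 1·c`, `Λ = 1`, `δ = 1`, `δ′ = 0`, `B = 0`, `k₀ = 0`, reach `1 + c/(1 − ω)`) delivers NE5
AT the attained threshold `ω + c` (`0 < ω`, `0 < c`, `ω + c ≤ 1`). [folklore] -/
theorem sharp_ne5_threshold_lip (hω : 0 < ω) (hc : 0 < c) (h1 : ω + c ≤ 1) :
    NE5 (sharpEA ω c) toyEB (Set.univ : Set (ℕ → ℝ)) 0 (ω + 1 * c)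
      ((1 * (1 + 0) + 0) * max 1 (1 * c / (ω + 1 * c - ω))) :=
  ne5_threshold_of_stepModel_lip_nat (sharpModel ω c) (ρ₀ := 1 + c / (1 - ω)) (B := 0) (k₀ := 0)
    (sharp_representsA ω c) (sharp_representsB ω c) (sharp_inBase ω c) (sharp_dataLipschitz ω c _)
    (sharp_decayA ω c (by linarith) h1) sharp_decayB (sharp_operatorRate ω c hω.le) (sharp_insertionRate ω c 0 ω)
    (sharp_insertionDampedNat ω c hω.le hc.le) zero_le_one (by norm_num) hω.le (by linarith) hc.le hω (by linarith)
    (by norm_num) le_rfl (fun k hk => absurd hk (Nat.not_lt_zero k)) (by linarith)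

/-- … with the numbers read off: the GENERAL closure gives `NE5 (sharpEA ω c) toyEB univ 0 (ω + c) 1` — exact in the RATE
(`sharp_ne5_iff`) AND in the CONSTANT (`1` is the least constant: scale `0`). [folklore] -/
theorem sharp_ne5_at_threshold_of_closure (hω : 0 < ω) (hc : 0 < c) (h1 : ω + c ≤ 1) :
    NE5 (sharpEA ω c) toyEB (Set.univ : Set (ℕ → ℝ)) 0 (ω + c) 1 := by
  have h := sharp_ne5_threshold_lip hω hc h1
  have e2 : (1 * (1 + 0) + 0) * max 1 (1 * c / (ω + 1 * c - ω)) = (1 : ℝ) := by simp [hc.ne']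
  have e1 : ω + 1 * c = ω + c := by ring
  rwa [e2, e1] at h

end Exact

section Resonance

/-- Run A of the RESONANT witness: `(1 + k·c/(ω + c))·(ω + c)^k` at a domain created at step `k`. [folklore] -/
def resEA (ω c : ℝ) : Functional toyCarriers toyCarriers.BgA :=
  fun _ _ X => (1 + (toyCarriers.scale X : ℝ) * c / (ω + c)) * (ω + c) ^ toyCarriers.scale X

/-- The RESONANT step model: `sharpModel ω c` with the operator data moved to the threshold rate, `(ω + c)^k` versus `0`
(`θ_op = ω + c = ω + Λ·c`, `Λ = 1`); output `o + h`, the geometric-memory insertion `sharpIns ω c` for both runs, base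
class `{(0, 0)}` and unit margins unchanged. [folklore] -/
def resModel (ω c : ℝ) : StepModel toyCarriers ℂ ℂ where
  Out := fun _ o h _ => o + h
  opA := fun _ _ k => (((ω + c) ^ k : ℝ) : ℂ)
  opB := fun _ _ _ => 0
  insA := fun _ _ k t => sharpIns ω c k t
  insB := fun _ _ k t => sharpIns ω c k t
  Base := fun _ _ _ => {p | p.1 = 0 ∧ p.2 = 0}
  rOp := fun _ => 1
  rHist := fun _ => 1
  rOp_pos := fun _ => one_pos
  rHist_pos := fun _ => one_pos

variable (ω c : ℝ)

/-- The resonant outputs solve the discrepancy recursion with operator source `(ω + c)^k` EXACTLY: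
`(ω + c)^k + c·Σ_{j<k} ω^{k−1−j}(1 + j·c/(ω + c))(ω + c)^j = (1 + k·c/(ω + c))(ω + c)^k` (`renewal_identity` at
`θ = ω + β`, `β = c`, `A = 1`; `ω + c ≠ 0`). [folklore] -/
theorem res_sum (hr : ω + c ≠ 0) (k : ℕ) :
    (ω + c) ^ k + c * ∑ j ∈ range k, ω ^ (k - 1 - j) * ((1 + j * c / (ω + c)) * (ω + c) ^ j)
      = (1 + k * c / (ω + c)) * (ω + c) ^ k := by
  have h := renewal_identity (θ := ω + c) (ω := ω) (β := c) (A := 1)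
    (E := fun k : ℕ => (1 + k * c / (ω + c)) * (ω + c) ^ k) (by simp)
    (fun k => by simp only [Nat.cast_succ]; field_simp; ring) k
  simpa only [one_mul] using h

/-- The resonant outputs ATTAIN the resonance budget of `boundedAtScale_resonance_of_recursiveRate` (`A = 1`, `b = c/ω`,
`(1 + b)ω = ω + c`; `ω ≠ 0`, `ω + c ≠ 0`). [folklore] -/
theorem res_attains_resonance_budget (hω : ω ≠ 0) (hr : ω + c ≠ 0) (g : ℕ → ℝ) (U : toyCarriers.BgA) (k : ℕ) :
    resEA ω c g U k = 1 * (1 + k * (c / ω) / (1 + c / ω)) * ((1 + c / ω) * ω) ^ k := by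
  show (1 + (k : ℝ) * c / (ω + c)) * (ω + c) ^ k = _
  have e1 : (1 + c / ω) * ω = ω + c := by field_simp
  have e2 : (k : ℝ) * (c / ω) / (1 + c / ω) = k * c / (ω + c) := by
    rw [← e1]
    field_simp
  rw [one_mul, e1, e2]

/-- Run B (`≡ 0`) is represented. [folklore] -/
theorem res_representsB : (resModel ω c).RepresentsB toyEB Set.univ := by
  intro g _ U X
  show (0 : ℝ) = ((0 : ℂ) + sharpIns ω c (toyCarriers.scale X) (tableB toyEB g U)).re
  rw [sharpIns_tableB, add_zero, Complex.zero_re]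

/-- Run A is represented (`ω + c ≠ 0`) — this IS `res_sum`. [folklore] -/
theorem res_representsA (hr : ω + c ≠ 0) : (resModel ω c).RepresentsA (resEA ω c) Set.univ := by
  intro g _ U X
  show (1 + (toyCarriers.scale X : ℝ) * c / (ω + c)) * (ω + c) ^ toyCarriers.scale X =
    ((((ω + c) ^ toyCarriers.scale X : ℝ) : ℂ) +
      ((c * ∑ j ∈ range (toyCarriers.scale X), ω ^ (toyCarriers.scale X - 1 - j) *
        ((1 + (j : ℝ) * c / (ω + c)) * (ω + c) ^ j) : ℝ) : ℂ)).re
  generalize toyCarriers.scale X = n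
  rw [Complex.add_re, Complex.ofReal_re, Complex.ofReal_re]
  exact (res_sum ω c hr n).symm

/-- Run B's data `(0, 0)` lie in the base class. [folklore] -/
theorem res_inBase : (resModel ω c).InBase toyEB Set.univ := by
  intro k g _ U
  show (resModel ω c).opB g U k = 0 ∧ sharpIns ω c k (tableB toyEB g U) = 0
  exact ⟨rfl, sharpIns_tableB ω c g U k⟩

/-- `o + h` is entire and bounded by `2` on the unit two-margin box around `(0, 0)`. [folklore] -/
theorem res_outputEnvelope : (resModel ω c).OutputEnvelope Set.univ 0 2 := by
  intro k g _ U p hp X _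
  have hp' : p.1 = 0 ∧ p.2 = 0 := hp
  refine ⟨?_, ?_⟩
  · show DifferentiableOn ℂ (fun z : ℂ × ℂ => z.1 + z.2) _
    exact (differentiable_fst.add differentiable_snd).differentiableOn
  · intro z hz
    simp only [StepModel.box, Set.mem_prod, mem_closedBall, dist_eq_norm] at hz
    show ‖z.1 + z.2‖ ≤ 2 * Real.exp (-(0 * toyCarriers.d X))
    rw [zero_mul, neg_zero, Real.exp_zero, mul_one]
    have h1 : ‖z.1‖ ≤ 1 := by
      have := hz.1
      rwa [hp'.1, sub_zero] at this
    have h2 : ‖z.2‖ ≤ 1 := by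
      have := hz.2
      rwa [hp'.2, sub_zero] at this
    exact (norm_add_le _ _).trans (by linarith)

/-- `DataLipschitz` with `Λ = 1` for every reach. [folklore] -/
theorem res_dataLipschitz (ρ₀ : ℝ) : (resModel ω c).DataLipschitz Set.univ 0 1 ρ₀ := by
  intro k g _ U p _ X _ q _ _
  show ‖(q.1 + q.2) - (p.1 + p.2)‖ ≤ 1 * (‖q.1 - p.1‖ / 1 + ‖q.2 - p.2‖ / 1) * Real.exp (-(0 * toyCarriers.d X))
  rw [zero_mul, neg_zero, Real.exp_zero, mul_one, one_mul, div_one, div_one,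
    show (q.1 + q.2) - (p.1 + p.2) = (q.1 - p.1) + (q.2 - p.2) by ring]
  exact norm_add_le _ _

/-- The species form with `Λop = Λhist = 1`, every reach. [folklore] -/
theorem res_dataLipschitz₂ (ρ₀ : ℝ) : DataLipschitz₂ (resModel ω c) Set.univ 0 1 1 ρ₀ :=
  dataLipschitz₂_of_dataLipschitz (resModel ω c) (res_dataLipschitz ω c ρ₀)

/-- `OpLipschitz` with modulus `1`, every reach. [folklore] -/
theorem res_opLipschitz (ρ₀ : ℝ) : OpLipschitz (resModel ω c) Set.univ 0 1 ρ₀ := by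
  intro k g _ U p _ X _ o _
  show ‖(o + p.2) - (p.1 + p.2)‖ ≤ 1 * (‖o - p.1‖ / 1) * Real.exp (-(0 * toyCarriers.d X))
  rw [zero_mul, neg_zero, Real.exp_zero, mul_one, one_mul, div_one, add_sub_add_right_eq_sub]

/-- `HistSecant K` with modulus `1` for every class `K`. [folklore] -/
theorem res_histSecant (K : ℕ → (ℕ → ℝ) → toyCarriers.BgB → Set (ℂ × ℂ)) :
    HistSecant (resModel ω c) K Set.univ 0 1 := by
  intro k g _ U o h h' _ _ X _
  show ‖(o + h') - (o + h)‖ ≤ 1 * (‖h' - h‖ / 1) * Real.exp (-(0 * toyCarriers.d X))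
  rw [zero_mul, neg_zero, Real.exp_zero, mul_one, one_mul, div_one, add_sub_add_left_eq_sub]

/-- The history leg's endpoints lie in the universal class. [folklore] -/
theorem res_histPairInClass :
    HistPairInClass (resModel ω c) (fun _ _ _ => Set.univ) (resEA ω c) toyEB Set.univ :=
  fun _ _ _ _ => ⟨Set.mem_univ _, Set.mem_univ _⟩

/-- One-run bound of run A with constant `1 + c/(1 − (ω + c))` (`0 < ω + c < 1`, `0 ≤ c`; `resSeq_le` at `θ′ = 1`).
[folklore] -/
theorem res_decayA (hr : 0 < ω + c) (hc : 0 ≤ c) (h1 : ω + c < 1) :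
    DecayBound (resEA ω c) Set.univ (1 + c / (1 - (ω + c))) 0 := by
  intro g _ U X
  show |(1 + (toyCarriers.scale X : ℝ) * c / (ω + c)) * (ω + c) ^ toyCarriers.scale X|
    ≤ (1 + c / (1 - (ω + c))) * Real.exp (-(0 * toyCarriers.d X))
  rw [zero_mul, neg_zero, Real.exp_zero, mul_one, abs_of_nonneg (mul_nonneg
    (add_nonneg zero_le_one (div_nonneg (mul_nonneg (Nat.cast_nonneg _) hc) hr.le)) (pow_nonneg hr.le _))]
  simpa only [one_pow, mul_one] using resSeq_le hr hc h1 (toyCarriers.scale X)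

/-- Operator discrepancy `(ω + c)^k`: operator rate `θ_op = ω + c` — THE THRESHOLD — with equality (`0 ≤ ω + c`).
[folklore] -/
theorem res_operatorRate (hr : 0 ≤ ω + c) : (resModel ω c).OperatorRate Set.univ 1 (ω + c) := by
  intro k g _ U
  show ‖(((ω + c) ^ k : ℝ) : ℂ) - 0‖ ≤ 1 * (ω + c) ^ k * 1
  rw [sub_zero, Complex.norm_real, Real.norm_eq_abs, abs_of_nonneg (pow_nonneg hr _), one_mul, mul_one]

/-- The two runs insert identically (`δ′ = 0`). [folklore] -/
theorem res_insertionRate (E₀ θ : ℝ) : (resModel ω c).InsertionRate Set.univ 0 E₀ 0 θ := by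
  intro k g _ U t _
  show ‖sharpIns ω c k t - sharpIns ω c k t‖ ≤ 0 * θ ^ k * 1
  rw [sub_self, norm_zero, zero_mul, zero_mul]

/-- The insertion is linear in the table. [folklore] -/
theorem res_insLinear : (resModel ω c).InsLinear Set.univ := fun k _ _ _ t t' => sharpIns_sub ω c k t t'

/-- Hence affine. [folklore] -/
theorem res_insAffine : (resModel ω c).InsAffine Set.univ :=
  (resModel ω c).insAffine_of_linear (res_insLinear ω c)

/-- The damped-Lipschitz insertion bound, natural gain `c`, damping `ω` (as for `sharpModel`). [folklore] -/
theorem res_insertionDampedNat (hω : 0 ≤ ω) (hc : 0 ≤ c) : (resModel ω c).InsertionDampedNat Set.univ 0 c ω := by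
  intro k g _ U t t' D hD ht
  show ‖sharpIns ω c k t - sharpIns ω c k t'‖ ≤ 1 * (c * ∑ j ∈ range k, ω ^ (k - 1 - j) * D j)
  rw [← sharpIns_sub, sharpIns, Complex.norm_real, Real.norm_eq_abs, one_mul, abs_mul, abs_of_nonneg hc]
  refine mul_le_mul_of_nonneg_left ((abs_sum_le_sum_abs _ _).trans (sum_le_sum fun j hj => ?_)) hc
  rw [abs_mul, abs_of_nonneg (pow_nonneg hω _)]
  refine mul_le_mul_of_nonneg_left ?_ (pow_nonneg hω _)
  have := ht j (mem_range.1 hj)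
  rwa [zero_mul, neg_zero, Real.exp_zero, mul_one] at this

variable {ω c} {θ' : ℝ}

/-- **NE5 HOLDS STRICTLY ABOVE THE THRESHOLD**, constant `1 + c/(θ′ − (ω + c))` (`resSeq_le`). [folklore] -/
theorem res_ne5_of_gt (hr : 0 < ω + c) (hc : 0 ≤ c) (hθ' : ω + c < θ') :
    NE5 (resEA ω c) toyEB (Set.univ : Set (ℕ → ℝ)) 0 θ' (1 + c / (θ' - (ω + c))) := by
  intro g _ U X
  show |(1 + (toyCarriers.scale X : ℝ) * c / (ω + c)) * (ω + c) ^ toyCarriers.scale X - 0|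
    ≤ (1 + c / (θ' - (ω + c))) * θ' ^ toyCarriers.scale X * Real.exp (-(0 * toyCarriers.d X))
  rw [sub_zero, zero_mul, neg_zero, Real.exp_zero, mul_one, abs_of_nonneg (mul_nonneg
    (add_nonneg zero_le_one (div_nonneg (mul_nonneg (Nat.cast_nonneg _) hc) hr.le)) (pow_nonneg hr.le _))]
  exact resSeq_le hr hc hθ' _

/-- **THE LIPSCHITZ-FACED CLOSURE FIRES STRICTLY ABOVE THE THRESHOLD** on the resonant witness: file v5's
`ne5_at_of_stepModel_lip_nat` applies for every `θ′ ∈ (ω + c, 1]` (`θ_op = ω + c`, `Λ = 1`, `δ = 1`, `δ′ = 0`, `k₀ = 0`,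
`B = 0`; `0 < ω`, `0 ≤ c`, `ω + c < 1`). [folklore] -/
theorem res_ne5_lip (hω : 0 < ω) (hc : 0 ≤ c) (h1 : ω + c < 1) (hθ' : ω + c < θ') (hθ'1 : θ' ≤ 1) :
    NE5 (resEA ω c) toyEB (Set.univ : Set (ℕ → ℝ)) 0 θ' ((1 * (1 + 0) + 0) * (θ' - ω) / (θ' - (ω + 1 * c))) :=
  have hr : 0 < ω + c := by linarith
  (resModel ω c).ne5_at_of_stepModel_lip_nat (ρ₀ := 1 + c * (1 + c / (1 - (ω + c))) / (1 - ω)) (B := 0)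
    (k₀ := 0) (res_representsA ω c hr.ne') (res_representsB ω c) (res_inBase ω c) (res_dataLipschitz ω c _)
    (res_decayA ω c hr hc h1) sharp_decayB (res_operatorRate ω c hr.le) (res_insertionRate ω c 0 (ω + c))
    (res_insertionDampedNat ω c hω.le hc) zero_le_one (by norm_num) hr.le hθ'.le hθ'1 hc hω (by norm_num) le_rfl
    (fun k hk => absurd hk (Nat.not_lt_zero k)) (by linarith)

/-- **NE5 FAILS AT THE THRESHOLD (and below it) FOR EVERY CONSTANT** on the resonant witness (`0 < ω + c`, `0 < c`): the
ratio `E_A(k)/(ω + c)^k = 1 + k·c/(ω + c)` is unbounded. [folklore] -/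
theorem res_not_ne5_of_le (hr : 0 < ω + c) (hc : 0 < c) (hθ' : θ' ≤ ω + c) (C₅ : ℝ) :
    ¬ NE5 (resEA ω c) toyEB (Set.univ : Set (ℕ → ℝ)) 0 θ' C₅ := by
  intro h
  have hk : ∀ k : ℕ, (1 + k * c / (ω + c)) * (ω + c) ^ k ≤ C₅ * θ' ^ k := fun k => by
    have e : |(1 + (k : ℝ) * c / (ω + c)) * (ω + c) ^ k - 0| ≤ C₅ * θ' ^ k * Real.exp (-(0 * (0 : ℝ))) :=
      h (fun _ => 1) (Set.mem_univ _) () k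
    rwa [sub_zero, zero_mul, neg_zero, Real.exp_zero, mul_one, abs_of_nonneg (mul_nonneg
      (add_nonneg zero_le_one (div_nonneg (mul_nonneg (Nat.cast_nonneg _) hc.le) hr.le)) (pow_nonneg hr.le _))] at e
  have h0 : 1 ≤ C₅ := by simpa using hk 0
  rcases le_or_gt θ' 0 with hle | hpos
  · have h1 := hk 1
    rw [Nat.cast_one, one_mul, pow_one, pow_one] at h1
    have hpos' : 0 < (1 + c / (ω + c)) * (ω + c) := mul_pos (by linarith [div_pos hc hr]) hr
    have hneg : C₅ * θ' ≤ 0 := mul_nonpos_iff.2 (Or.inl ⟨by linarith, hle⟩)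
    linarith
  · obtain ⟨k, hkC⟩ := exists_nat_gt ((C₅ - 1) * (ω + c) / c)
    have hrk : 0 < (ω + c) ^ k := pow_pos hr k
    have hle : (1 + k * c / (ω + c)) * (ω + c) ^ k ≤ C₅ * (ω + c) ^ k :=
      (hk k).trans (mul_le_mul_of_nonneg_left (pow_le_pow_left₀ hpos.le hθ' k) (by linarith))
    have h2 : (k : ℝ) * c / (ω + c) ≤ C₅ - 1 := by linarith [le_of_mul_le_mul_right hle hrk]
    rw [div_le_iff₀ hr] at h2
    rw [div_lt_iff₀ hc] at hkC
    linarith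

/-- **THE RATE SET OF THE RESONANT WITNESS IS THE OPEN HALF-LINE `{θ′ | ω + c < θ′}`** (`0 < ω + c`, `0 < c`): the
threshold `ω + Λ·c = θ_op` itself is NOT an NE5 rate. [folklore] -/
theorem res_ne5_iff (hr : 0 < ω + c) (hc : 0 < c) (θ' : ℝ) :
    (∃ C₅, NE5 (resEA ω c) toyEB (Set.univ : Set (ℕ → ℝ)) 0 θ' C₅) ↔ ω + c < θ' :=
  ⟨fun ⟨C₅, h⟩ => not_le.1 fun hle => res_not_ne5_of_le hr hc hle C₅ h, fun h => ⟨_, res_ne5_of_gt hr hc.le h⟩⟩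

/-- **RESONANCE, in one statement** (`0 < ω`, `0 < c`, `ω + c < 1`): on the resonant witness (α) the closures fire at every
`θ′ ∈ (ω + c, 1]` and (β) NE5 fails at every `θ′ ≤ ω + c = θ_op` for every constant — at resonance the strict inequality of
the consumed smallness is NECESSARY at the interface, not an artefact of the geometric series. [folklore] -/
theorem resonance_two_sided (hω : 0 < ω) (hc : 0 < c) (h1 : ω + c < 1) :
    (∀ θ', ω + c < θ' → θ' ≤ 1 → ∃ C₅, NE5 (resEA ω c) toyEB (Set.univ : Set (ℕ → ℝ)) 0 θ' C₅) ∧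
      ∀ θ', θ' ≤ ω + c → ∀ C₅, ¬ NE5 (resEA ω c) toyEB (Set.univ : Set (ℕ → ℝ)) 0 θ' C₅ :=
  ⟨fun _ hθ' hθ'1 => ⟨_, res_ne5_lip hω hc.le h1 hθ' hθ'1⟩,
    fun _ hθ' C₅ => res_not_ne5_of_le (by linarith) hc hθ' C₅⟩

end Resonance

/-! ## §8 (file v1.1, ADDITIVE) The numbers at `ω = 1/2`, `c = 1/4` (threshold `3/4`): off resonance (`θ_op = 1/2`) the
## general closure gives NE5 AT `3/4` with the true constant `1`; at resonance (`θ_op = 3/4`) NE5 at `3/4` fails -/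

section NumbersThreshold

/-- At `ω = 1/2`, `c = 1/4`: (i) on the §1 witness (`θ_op = 1/2`) the threshold closure gives NE5 AT `3/4 = 1/2 + 1/4`
with constant `1`; (ii) on the resonant witness (`θ_op = 3/4`) NE5 at `3/4` FAILS for every constant, (iii) holds at
`θ′ = 1` with constant `1 + (1/4)/(1/4) = 2`, and (iv) the Lipschitz-faced closure fires at every `θ′ ∈ (3/4, 1]`.
[folklore] -/
theorem threshold_three_quarters :
    NE5 (sharpEA (1 / 2) (1 / 4)) toyEB (Set.univ : Set (ℕ → ℝ)) 0 (1 / 2 + 1 / 4) 1 ∧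
    (∀ C₅, ¬ NE5 (resEA (1 / 2) (1 / 4)) toyEB (Set.univ : Set (ℕ → ℝ)) 0 (3 / 4) C₅) ∧
    NE5 (resEA (1 / 2) (1 / 4)) toyEB (Set.univ : Set (ℕ → ℝ)) 0 1 (1 + 1 / 4 / (1 - (1 / 2 + 1 / 4))) ∧
    ∀ θ' : ℝ, 3 / 4 < θ' → θ' ≤ 1 →
      NE5 (resEA (1 / 2) (1 / 4)) toyEB (Set.univ : Set (ℕ → ℝ)) 0 θ'
        ((1 * (1 + 0) + 0) * (θ' - 1 / 2) / (θ' - (1 / 2 + 1 * (1 / 4)))) := by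
  refine ⟨sharp_ne5_at_threshold_of_closure (by norm_num) (by norm_num) (by norm_num),
    fun C₅ => res_not_ne5_of_le (by norm_num) (by norm_num) (by norm_num) C₅,
    res_ne5_of_gt (by norm_num) (by norm_num) (by norm_num),
    fun θ' h h1 => res_ne5_lip (by norm_num) (by norm_num) (by norm_num) (by norm_num; exact h) h1⟩

/-- [analysis] The numbers: threshold `1/2 + 1/4 = 3/4`; the resonant constants above it, `1 + (1/4)/(θ′ − 3/4)`, are `2`
at `θ′ = 1` and `6` at `θ′ = 4/5` (the values of the closures' constant in §4 — on the resonant witness they are of the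
right order); the resonance budget `(1 + k/3)(3/4)^k` at `k = 3` is `2·27/64 = 27/32`. [folklore] -/
example : (1 : ℝ) / 2 + 1 / 4 = 3 / 4 ∧ (1 : ℝ) + 1 / 4 / (1 - 3 / 4) = 2 ∧ (1 : ℝ) + 1 / 4 / (4 / 5 - 3 / 4) = 6 ∧
    ((1 : ℝ) + 3 * (1 / 4) / (1 / 2 + 1 / 4)) * (1 / 2 + 1 / 4) ^ 3 = 27 / 32 := by norm_num

end NumbersThreshold

end Literature.MathematicalPhysics.QuantumFieldTheory.Balaban1983to89.T4InputCauchyRateSharp
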